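import Summits.NavierStokesRegularity.NavierStokesRegularity.Theorems.EfficiencyFloorMaximiserSetRigidityResidual
import HarnessLib

/-!
# Route `EfficiencyFloor`, crux `MaximiserSetRigidity` (stmt-NavierStokesRegularity-25512), part (b), rotating case:
# the drift is removed by a translation for EVERY skew `W` (the residual (L⁺_rot) is driftless)

Helper file (`--supports stmt-NavierStokesRegularity-25512`). Sequel to `…ProfileLiouvilleDrift` (drift removal at
`W = 0`, translation by `a/c′`) and `…Residual` (`MaximiserSetRigidity ⟸ PartA ∧ (L⁺_rot)`). For a skew-adjoint `W`
and `c′ ≠ 0` the affine generator `x ↦ c′x + Wx` is invertible (`⟪(c′ + W)x, x⟫ = c′|x|²`), so the drift `a` of the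
relative-equilibrium equation `νΔm − (m·∇)m − ∇π = (a·∇)m + ((Wx)·∇)m − Wm + c′(m + (x·∇)m)` is absorbed by the
translation `m̃(y) = m(y − x₀)`, `π̃(y) = π(y − x₀)` with `c′x₀ + Wx₀ = a`:
`νΔm̃ − (m̃·∇)m̃ − ∇π̃ = ((Wy)·∇)m̃ − Wm̃ + c′(m̃ + (y·∇)m̃)` (same `W`, same `c′`, same admissibility, same enstrophy).

* `exists_affineCentre` — for skew `W` and `c′ ≠ 0` every `a` is `c′x₀ + Wx₀` for some `x₀`;
* `rotatingCollapseLiouville_of_noDrift` — (L⁺_rot) (verbatim the hypothesis `hL` of the landed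
  `maximiserSetRigidity_of_partA_of_rotatingCollapseLiouville`) follows from its DRIFTLESS case (no admissible `m`
  with `Z(m) > 0` solves `νΔm − (m·∇)m − ∇π = ((Wx)·∇)m − Wm + c′(m + (x·∇)m)` with `W ≠ 0` skew, `c′ > 0`;
  both spelled out inline, no new definitions);
* `maximiserSetRigidity_of_partA_of_rotatingCollapseLiouvilleNoDrift` — BY NAME: the route decl
  `MaximiserSetRigidity` follows from part (a) and the driftless rotating collapse Liouville theorem alone.

So the exact analytic residual of part (b) is the driftless rotating backward self-similar Liouville theorem in the
finite-energy smooth class — the statement the orbit construction `u(t,x) = λ(t)R(t)m(λ(t)R(t)ᵀx)` plus the tree's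
PROVED `Literature.Analysis.FluidPDE.seregin_L3_blowup_holds` (Seregin 2012, no rapid-decay hypothesis) is expected
to settle. HONEST FRAMING: implications; (L⁺_rot), part (a), `RigidExit`, `LerayFloorGap`, `ProductionEfficiencyDecay`
and Navier–Stokes regularity stay OPEN; no summit statement is proved. [folklore]
-/

noncomputable section

-- the problem directory repeats the summit name (`NavierStokesRegularity/NavierStokesRegularity`)
set_option linter.dupNamespace false

namespace Summit.NavierStokesRegularity.NavierStokesRegularity.Theorems

namespace MaximiserSetRigidity

namespace ProfileLiouville

open MeasureTheory Set Filter Topology Module InnerProductSpace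
open scoped RealInnerProductSpace Laplacian ContDiff ENNReal
open Literature.Analysis Literature.Analysis.FluidPDE

/-- **The affine generator `x ↦ c′x + Wx` is onto** for skew-adjoint `W` and `c′ ≠ 0`: `⟪c′x + Wx, x⟫ = c′|x|²`
makes it injective, hence surjective in finite dimension. [folklore] -/
theorem exists_affineCentre (W : EuclideanSpace ℝ (Fin 3) →L[ℝ] EuclideanSpace ℝ (Fin 3))
    (hW : ∀ x y : EuclideanSpace ℝ (Fin 3), ⟪W x, y⟫_ℝ = -⟪x, W y⟫_ℝ) {c' : ℝ} (hc' : c' ≠ 0)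
    (a : EuclideanSpace ℝ (Fin 3)) : ∃ x₀ : EuclideanSpace ℝ (Fin 3), c' • x₀ + W x₀ = a := by
  set A : EuclideanSpace ℝ (Fin 3) →ₗ[ℝ] EuclideanSpace ℝ (Fin 3) :=
    c' • LinearMap.id + (W : EuclideanSpace ℝ (Fin 3) →ₗ[ℝ] EuclideanSpace ℝ (Fin 3)) with hA
  have hAx : ∀ x, A x = c' • x + W x := fun x => by
    simp [hA]
  have hskew : ∀ x : EuclideanSpace ℝ (Fin 3), ⟪W x, x⟫_ℝ = 0 := fun x => by
    have h := hW x x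
    rw [real_inner_comm (W x) x] at h
    linarith
  have hinj : Function.Injective A := by
    intro x y hxy
    have h0 : A (x - y) = 0 := by rw [map_sub, hxy, sub_self]
    have h1 : ⟪A (x - y), x - y⟫_ℝ = c' * ‖x - y‖ ^ 2 := by
      rw [hAx, inner_add_left, real_inner_smul_left, real_inner_self_eq_norm_sq, hskew, add_zero]
    rw [h0, inner_zero_left] at h1
    have h2 : ‖x - y‖ ^ 2 = 0 := by
      rcases mul_eq_zero.1 h1.symm with h | h
      · exact absurd h hc'
      · exact h
    rw [sq_eq_zero_iff, norm_eq_zero, sub_eq_zero] at h2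
    exact h2
  obtain ⟨x₀, hx₀⟩ := (LinearMap.injective_iff_surjective.1 hinj) a
  exact ⟨x₀, by rw [← hAx, hx₀]⟩

/-- **(L⁺_rot) ⟸ its driftless case.** If `νΔm − (m·∇)m − ∇π = (a·∇)m + ((Wx)·∇)m − Wm + c′(m + (x·∇)m)` with `W`
skew and `c′ > 0`, choose `x₀` with `c′x₀ + Wx₀ = a`; then `m̃(y) = m(y − x₀)`, `π̃(y) = π(y − x₀)` are admissible
with the same enstrophy and solve the driftless equation with the same `W`, `c′`. [folklore] -/
theorem rotatingCollapseLiouville_of_noDrift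
    (h0 : ∀ (ν : ℝ), 0 < ν → ∀ (m : EuclideanSpace ℝ (Fin 3) → EuclideanSpace ℝ (Fin 3)) (π : EuclideanSpace ℝ (Fin 3) → ℝ)
          (W : EuclideanSpace ℝ (Fin 3) →L[ℝ] EuclideanSpace ℝ (Fin 3)) (c' : ℝ),
          (ContDiff ℝ (⊤ : ℕ∞) m ∧ Literature.Analysis.FluidPDE.VectorCalculus.IsDivFree m ∧ (∫⁻ x,
            ‖iteratedFDeriv ℝ 0 m x‖ₑ ^ 2 < ⊤) ∧ (∫⁻ x, ‖iteratedFDeriv ℝ 1 m x‖ₑ ^ 2 < ⊤) ∧ (∫⁻ x, ‖iteratedFDeriv ℝ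
            2 m x‖ₑ ^ 2 < ⊤)) → 0 < (∫ x, ‖Literature.Analysis.FluidPDE.curl m x‖ ^ 2) → ContDiff ℝ (⊤ : ℕ∞) π → (∀ x
            y : EuclideanSpace ℝ (Fin 3), ⟪W x, y⟫_ℝ = -⟪x, W y⟫_ℝ) → W ≠ 0 → 0 < c' → ¬ (∀ x : EuclideanSpace ℝ (Fin
            3), ν • Laplacian.laplacian m x - Literature.Analysis.FluidPDE.convect m m x - gradient π x =
            (fderiv ℝ m x (W x) - W (m x)) + c' • (m x + fderiv ℝ m x x))) :
    ∀ (ν : ℝ), 0 < ν → ∀ (m : EuclideanSpace ℝ (Fin 3) → EuclideanSpace ℝ (Fin 3)) (π : EuclideanSpace ℝ (Fin 3) → ℝ)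
        (a : EuclideanSpace ℝ (Fin 3)) (W : EuclideanSpace ℝ (Fin 3) →L[ℝ] EuclideanSpace ℝ (Fin 3)) (c' : ℝ),
        (ContDiff ℝ (⊤ : ℕ∞) m ∧ Literature.Analysis.FluidPDE.VectorCalculus.IsDivFree m ∧ (∫⁻ x,
          ‖iteratedFDeriv ℝ 0 m x‖ₑ ^ 2 < ⊤) ∧ (∫⁻ x, ‖iteratedFDeriv ℝ 1 m x‖ₑ ^ 2 < ⊤) ∧ (∫⁻ x, ‖iteratedFDeriv ℝ
          2 m x‖ₑ ^ 2 < ⊤)) → 0 < (∫ x, ‖Literature.Analysis.FluidPDE.curl m x‖ ^ 2) → ContDiff ℝ (⊤ : ℕ∞) π → (∀ x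
          y : EuclideanSpace ℝ (Fin 3), ⟪W x, y⟫_ℝ = -⟪x, W y⟫_ℝ) → W ≠ 0 → 0 < c' → ¬ (∀ x : EuclideanSpace ℝ (Fin
          3), ν • Laplacian.laplacian m x - Literature.Analysis.FluidPDE.convect m m x - gradient π x = fderiv ℝ m x
          a + (fderiv ℝ m x (W x) - W (m x)) + c' • (m x + fderiv ℝ m x x)) := by
  intro ν hν m π a W c' hadm hZ hπ hW hW0 hc' heq
  obtain ⟨hm, hdiv, hi0, hi1, hi2⟩ := hadm
  obtain ⟨d, hd⟩ := exists_affineCentre W hW hc'.ne' a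
  -- the translate
  set mt : (EuclideanSpace ℝ (Fin 3)) → (EuclideanSpace ℝ (Fin 3)) := fun y => m (y - d) with hmt_def
  set πt : (EuclideanSpace ℝ (Fin 3)) → ℝ := fun y => π (y - d) with hπt_def
  have hτ : ContDiff ℝ (⊤ : ℕ∞) (fun y : EuclideanSpace ℝ (Fin 3) => y - d) := contDiff_id.sub contDiff_const
  have hmt : ContDiff ℝ (⊤ : ℕ∞) mt := hm.comp hτ
  have hπt : ContDiff ℝ (⊤ : ℕ∞) πt := hπ.comp hτ
  have hdivt : VectorCalculus.IsDivFree mt := fun y => by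
    rw [hmt_def, divergence_comp_sub_right]
    exact hdiv _
  have h0t : ∫⁻ y, ‖iteratedFDeriv ℝ 0 mt y‖ₑ ^ 2 < ⊤ := by
    rw [hmt_def, lintegral_iteratedFDeriv_translate]; exact hi0
  have h1t : ∫⁻ y, ‖iteratedFDeriv ℝ 1 mt y‖ₑ ^ 2 < ⊤ := by
    rw [hmt_def, lintegral_iteratedFDeriv_translate]; exact hi1
  have h2t : ∫⁻ y, ‖iteratedFDeriv ℝ 2 mt y‖ₑ ^ 2 < ⊤ := by
    rw [hmt_def, lintegral_iteratedFDeriv_translate]; exact hi2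
  have hZt : 0 < (∫ y, ‖curl mt y‖ ^ 2) := by
    have e : (fun y => ‖curl mt y‖ ^ 2) = fun y => (fun x => ‖curl m x‖ ^ 2) (y - d) := by
      funext y
      simp only [hmt_def, curl_translate]
    rw [e, integral_sub_right_eq_self (fun x => ‖curl m x‖ ^ 2) d]
    exact hZ
  -- the translated (driftless) equation
  have heqt : ∀ y : EuclideanSpace ℝ (Fin 3), ν • Δ mt y - convect mt mt y - gradient πt y =
      (fderiv ℝ mt y (W y) - W (mt y)) + c' • (mt y + fderiv ℝ mt y y) := by
    intro y
    have h := heq (y - d)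
    have eΔ : Δ mt y = Δ m (y - d) := laplacian_comp_sub_right m d y
    have eD : fderiv ℝ mt y = fderiv ℝ m (y - d) := fderiv_comp_sub_right m d y
    have eπ : gradient πt y = gradient π (y - d) := by
      unfold gradient
      rw [fderiv_comp_sub_right π d y]
    have ec : convect mt mt y = convect m m (y - d) := by
      unfold convect
      rw [eD]
    rw [eΔ, ec, eπ, eD, h]
    have hy : (fderiv ℝ m (y - d)) (y - d) = fderiv ℝ m (y - d) y - fderiv ℝ m (y - d) d := by
      rw [map_sub]
    have hWy : (fderiv ℝ m (y - d)) (W (y - d)) = fderiv ℝ m (y - d) (W y) - fderiv ℝ m (y - d) (W d) := by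
      rw [map_sub, map_sub]
    have ha : fderiv ℝ m (y - d) a = c' • fderiv ℝ m (y - d) d + fderiv ℝ m (y - d) (W d) := by
      rw [← hd, map_add, map_smul]
    rw [hy, hWy, ha, smul_add, smul_add, smul_sub]
    abel
  exact h0 ν hν mt πt W c' ⟨hmt, hdivt, h0t, h1t, h2t⟩ hZt hπt hW hW0 hc' heqt

/-- **`MaximiserSetRigidity` ⟸ part (a) ∧ driftless (L⁺_rot)** — BY NAME against the route decl: the (b)-half of
stmt-25512 is reduced to the driftless rotating collapse Liouville theorem and nothing else
(`maximiserSetRigidity_of_partA_of_rotatingCollapseLiouville` + `rotatingCollapseLiouville_of_noDrift`). [folklore] -/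
theorem maximiserSetRigidity_of_partA_of_rotatingCollapseLiouvilleNoDrift
    (hA : ∀ c ν : ℝ, (0 < c ∧ (∀ v : EuclideanSpace ℝ (Fin 3) → EuclideanSpace ℝ (Fin 3), (ContDiff ℝ (⊤ : ℕ∞) v ∧
      Literature.Analysis.FluidPDE.VectorCalculus.IsDivFree v ∧ (∫⁻ x, ‖iteratedFDeriv ℝ 0 v x‖ₑ ^ 2 < ⊤) ∧
      (∫⁻ x, ‖iteratedFDeriv ℝ 1 v x‖ₑ ^ 2 < ⊤) ∧ (∫⁻ x, ‖iteratedFDeriv ℝ 2 v x‖ₑ ^ 2 < ⊤)) → (∫ x,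
      ⟪Literature.Analysis.FluidPDE.curl v x, fderiv ℝ v x (Literature.Analysis.FluidPDE.curl v x)⟫_ℝ) ≤ c *
      (∫ x, ‖Literature.Analysis.FluidPDE.curl v x‖ ^ 2) ^ (3 / 4 : ℝ) * (∫ x,
      Literature.Analysis.FluidPDE.frobeniusNormSq (fderiv ℝ (Literature.Analysis.FluidPDE.curl v) x)) ^ (3 / 4
      : ℝ)) ∧ ∀ c' : ℝ, (∀ w : EuclideanSpace ℝ (Fin 3) → EuclideanSpace ℝ (Fin 3), (ContDiff ℝ (⊤ : ℕ∞) w ∧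
      Literature.Analysis.FluidPDE.VectorCalculus.IsDivFree w ∧ (∫⁻ x, ‖iteratedFDeriv ℝ 0 w x‖ₑ ^ 2 < ⊤) ∧
      (∫⁻ x, ‖iteratedFDeriv ℝ 1 w x‖ₑ ^ 2 < ⊤) ∧ (∫⁻ x, ‖iteratedFDeriv ℝ 2 w x‖ₑ ^ 2 < ⊤)) → (∫ x,
      ⟪Literature.Analysis.FluidPDE.curl w x, fderiv ℝ w x (Literature.Analysis.FluidPDE.curl w x)⟫_ℝ) ≤ c' *
      (∫ x, ‖Literature.Analysis.FluidPDE.curl w x‖ ^ 2) ^ (3 / 4 : ℝ) * (∫ x,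
      Literature.Analysis.FluidPDE.frobeniusNormSq (fderiv ℝ (Literature.Analysis.FluidPDE.curl w) x)) ^ (3 / 4
      : ℝ)) → c ≤ c') → 0 < ν → ∃ (k : ℕ) (ms : Fin k → EuclideanSpace ℝ (Fin 3) → EuclideanSpace ℝ (Fin 3)), (∀
      i, ((ContDiff ℝ (⊤ : ℕ∞) (ms i) ∧ Literature.Analysis.FluidPDE.VectorCalculus.IsDivFree (ms i) ∧ (∫⁻ x,
      ‖iteratedFDeriv ℝ 0 (ms i) x‖ₑ ^ 2 < ⊤) ∧ (∫⁻ x, ‖iteratedFDeriv ℝ 1 (ms i) x‖ₑ ^ 2 < ⊤) ∧ (∫⁻ x,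
      ‖iteratedFDeriv ℝ 2 (ms i) x‖ₑ ^ 2 < ⊤)) ∧ 0 < (∫ x, ‖Literature.Analysis.FluidPDE.curl (ms i) x‖ ^ 2) ∧
      (∫ x, ⟪Literature.Analysis.FluidPDE.curl (ms i) x, fderiv ℝ (ms i) x (Literature.Analysis.FluidPDE.curl
      (ms i) x)⟫_ℝ) = c * (∫ x, ‖Literature.Analysis.FluidPDE.curl (ms i) x‖ ^ 2) ^ (3 / 4 : ℝ) * (∫ x,
      Literature.Analysis.FluidPDE.frobeniusNormSq (fderiv ℝ (Literature.Analysis.FluidPDE.curl (ms i)) x)) ^ (3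
      / 4 : ℝ) ∧ (∫ x, Literature.Analysis.FluidPDE.frobeniusNormSq (fderiv ℝ (Literature.Analysis.FluidPDE.curl
      (ms i)) x)) = 81 * c ^ 4 / (256 * ν ^ 4) * (∫ x, ‖Literature.Analysis.FluidPDE.curl (ms i) x‖ ^ 2) ^ 3)) ∧
      ∀ m : EuclideanSpace ℝ (Fin 3) → EuclideanSpace ℝ (Fin 3), ((ContDiff ℝ (⊤ : ℕ∞) m ∧
      Literature.Analysis.FluidPDE.VectorCalculus.IsDivFree m ∧ (∫⁻ x, ‖iteratedFDeriv ℝ 0 m x‖ₑ ^ 2 < ⊤) ∧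
      (∫⁻ x, ‖iteratedFDeriv ℝ 1 m x‖ₑ ^ 2 < ⊤) ∧ (∫⁻ x, ‖iteratedFDeriv ℝ 2 m x‖ₑ ^ 2 < ⊤)) ∧ 0 < (∫ x,
      ‖Literature.Analysis.FluidPDE.curl m x‖ ^ 2) ∧ (∫ x, ⟪Literature.Analysis.FluidPDE.curl m x, fderiv ℝ m x
      (Literature.Analysis.FluidPDE.curl m x)⟫_ℝ) = c * (∫ x, ‖Literature.Analysis.FluidPDE.curl m x‖ ^ 2) ^ (3
      / 4 : ℝ) * (∫ x, Literature.Analysis.FluidPDE.frobeniusNormSq (fderiv ℝ (Literature.Analysis.FluidPDE.curl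
      m) x)) ^ (3 / 4 : ℝ) ∧ (∫ x, Literature.Analysis.FluidPDE.frobeniusNormSq (fderiv ℝ
      (Literature.Analysis.FluidPDE.curl m) x)) = 81 * c ^ 4 / (256 * ν ^ 4) * (∫ x,
      ‖Literature.Analysis.FluidPDE.curl m x‖ ^ 2) ^ 3) → (∃ (i : Fin k) (a : EuclideanSpace ℝ (Fin 3)) (R :
      EuclideanSpace ℝ (Fin 3) ≃ₗᵢ[ℝ] EuclideanSpace ℝ (Fin 3)) (l : ℝ), 0 < l ∧ m = fun x => l • R (ms i (l •
      R.symm (x - a)))))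
    (hL0 : ∀ (ν : ℝ), 0 < ν → ∀ (m : EuclideanSpace ℝ (Fin 3) → EuclideanSpace ℝ (Fin 3)) (π : EuclideanSpace ℝ (Fin 3) → ℝ)
          (W : EuclideanSpace ℝ (Fin 3) →L[ℝ] EuclideanSpace ℝ (Fin 3)) (c' : ℝ),
          (ContDiff ℝ (⊤ : ℕ∞) m ∧ Literature.Analysis.FluidPDE.VectorCalculus.IsDivFree m ∧ (∫⁻ x,
            ‖iteratedFDeriv ℝ 0 m x‖ₑ ^ 2 < ⊤) ∧ (∫⁻ x, ‖iteratedFDeriv ℝ 1 m x‖ₑ ^ 2 < ⊤) ∧ (∫⁻ x, ‖iteratedFDeriv ℝ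
            2 m x‖ₑ ^ 2 < ⊤)) → 0 < (∫ x, ‖Literature.Analysis.FluidPDE.curl m x‖ ^ 2) → ContDiff ℝ (⊤ : ℕ∞) π → (∀ x
            y : EuclideanSpace ℝ (Fin 3), ⟪W x, y⟫_ℝ = -⟪x, W y⟫_ℝ) → W ≠ 0 → 0 < c' → ¬ (∀ x : EuclideanSpace ℝ (Fin
            3), ν • Laplacian.laplacian m x - Literature.Analysis.FluidPDE.convect m m x - gradient π x =
            (fderiv ℝ m x (W x) - W (m x)) + c' • (m x + fderiv ℝ m x x))) :
    Summit.NavierStokesRegularity.NavierStokesRegularity.Theses.EfficiencyFloor.MaximiserSetRigidity :=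
  maximiserSetRigidity_of_partA_of_rotatingCollapseLiouville hA (rotatingCollapseLiouville_of_noDrift hL0)

end ProfileLiouville

end MaximiserSetRigidity

end Summit.NavierStokesRegularity.NavierStokesRegularity.Theorems

end
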